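import Literature.GroupTheory.TwoGroupCyclicIndexTwoUniqueInvolution
import HarnessLib

/-!
# A generalised quaternion subgroup of index two in a `2`-group with a unique involution forces a cyclic subgroup of index two

COR-CM (cell `pub-hodgecm2`), binder seat b04 (gen 34), count-neutral own lane «Galois-CM-type classification».  KERNEL ONLY,
Mathlib only (plus the gen-34 feeder `CorCM/TwoGroupCyclicIndexTwoUniqueInvolution`): theorems; no definition, no named fact, no
`sorry`.  The inductive step of the classical theorem «a finite `2`-group with a unique involution is cyclic or generalised
quaternion» [Rotman1995, Thm. 5.46] in the case where the subgroup `H` of index two is generalised quaternion `Q_{2^(m+1)}` with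
cyclic part `A = ⟨a⟩` (`|a| = 2^m`, every `h ∈ H ∖ A` inverts `a` and squares to `z = a^(2^(m-1))`).  For `m ≥ 3` (`§2`): `A ◁ G`
(a conjugate of `a` outside `A` would square to the unique involution `z`, forcing `a² = z`); for `y ∉ H` either `y² ∉ A` — then
`y²` inverts `a` while `y² a y⁻² = a^(r²)`, i.e. `2^m ∣ r² + 1`, impossible mod `4` — or `y² ∈ A`, and the index-two subgroup
`A ∪ yA = π⁻¹⟨π y⟩` (`π : G → G/A`, `|G/A| = 4`) is cyclic (done) or of quaternion type, in which case `x₀ y'` (`x₀ ∈ H ∖ A`,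
`y' ∈ yA` inverting `a`) CENTRALISES `a` and `A ∪ x₀y'A` is cyclic or yields `a = a⁻¹`.  For `m = 2` (`§3`, `H ≅ Q₈`, `|G| = 16`):
if no element has order `8`, every element outside `{1, z}` squares to `z`, so `y ∉ H` inverts `a`, `x₀` and `a x₀` by
conjugation, whence `a x₀ = x₀ a` — absurd.  Consumer: `CorCM/TwoGroupUniqueInvolution` (the induction) and
`CorCM/GaloisMinimalTwoPowerClassification` (gen 34).

* `subsingleton_involution_subgroup`, `mem_zpowers_coe_iff`, `mem_zpowers_mk_iff` — small tools.
* `exists_orderOf_eq_of_quaternion_subgroup` (`m ≥ 3`) and `exists_orderOf_eq_of_quaternion_subgroup_two` (`m = 2`) — `G` is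
  cyclic or has an element of order `2^(m+1)`.

## References

* [Rotman1995] J. J. Rotman, *An Introduction to the Theory of Groups*, 4th ed., GTM 148, Springer 1995, Thm. 5.46 (with Cor. 5.45).

Provenance: Literature home (namespace `Literature.GroupTheory.UniqueInvolution`) of the Summits-side `CorCM/TwoGroupQuaternionSubgroupIndexTwo` (cell `pub-hodgecm2`, COR-CM; all its imports are `Literature/`, Mathlib and the already re-homed `TwoGroupCyclicIndexTwoUniqueInvolution`), which `Literature/` may not import; theorems only, no named fact, no definition. Nothing here bears on `HC_CM`. Lane `lit-hodgefound` (Layer A3: CM types, their Kubota ranks and Galois combinatorics), seat p20.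
-/

namespace Literature.GroupTheory.UniqueInvolution

variable {G : Type*} [Group G]

/-! ## §1 Small tools -/

/-- The «at most one involution» hypothesis passes to subgroups. [cite: Rotman1995, Thm. 5.46] -/
theorem subsingleton_involution_subgroup (huniq : ∀ s t : G, s * s = 1 → s ≠ 1 → t * t = 1 → t ≠ 1 → s = t)
    (K : Subgroup G) : ∀ s t : K, s * s = 1 → s ≠ 1 → t * t = 1 → t ≠ 1 → s = t := by
  intro s t hs hs1 ht ht1
  apply Subtype.ext
  refine huniq _ _ ?_ ?_ ?_ ?_
  · simpa using congrArg Subtype.val hs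
  · exact fun h => hs1 (Subtype.ext h)
  · simpa using congrArg Subtype.val ht
  · exact fun h => ht1 (Subtype.ext h)

/-- Membership in `⟨a⟩` for elements of a subgroup `K ∋ a` does not depend on the ambient group. [cite: Rotman1995, Thm. 5.46] -/
theorem mem_zpowers_coe_iff {K : Subgroup G} (a x : K) :
    x ∈ Subgroup.zpowers a ↔ (x : G) ∈ Subgroup.zpowers (a : G) := by
  simp only [Subgroup.mem_zpowers_iff]
  constructor
  · rintro ⟨i, hi⟩
    exact ⟨i, by rw [← hi]; simp⟩
  · rintro ⟨i, hi⟩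
    exact ⟨i, Subtype.ext (by simp [hi])⟩

/-- The same with `a` given as an element of `G` lying in `K`. [cite: Rotman1995, Thm. 5.46] -/
theorem mem_zpowers_mk_iff {K : Subgroup G} {a : G} (ha : a ∈ K) (x : K) :
    x ∈ Subgroup.zpowers (⟨a, ha⟩ : K) ↔ (x : G) ∈ Subgroup.zpowers a :=
  mem_zpowers_coe_iff ⟨a, ha⟩ x

/-! ## §2 A generalised quaternion subgroup of index two (`m ≥ 3`) -/

/-- **A quaternion subgroup of index two forces a cyclic subgroup of index two** (`m ≥ 3`).  `|G| = 2^(m+2)` with at most one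
involution, `H ≤ G` of index `2`, `a ∈ H` of order `2^m`, and every `h ∈ H ∖ ⟨a⟩` inverts `a` and squares to `a^(2^(m-1))`
⟹ `G` is cyclic or contains an element of order `2^(m+1)`. [cite: Rotman1995, Thm. 5.46] -/
theorem exists_orderOf_eq_of_quaternion_subgroup [Finite G] {H : Subgroup G} {a : G} {m : ℕ} (hm : 3 ≤ m)
    (hcard : Nat.card G = 2 ^ (m + 2)) (hH : H.index = 2) (haH : a ∈ H) (ha : orderOf a = 2 ^ m)
    (hrel : ∀ h ∈ H, h ∉ Subgroup.zpowers a → h * a * h⁻¹ = a⁻¹ ∧ h * h = a ^ (2 ^ (m - 1)))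
    (huniq : ∀ s t : G, s * s = 1 → s ≠ 1 → t * t = 1 → t ≠ 1 → s = t) :
    IsCyclic G ∨ ∃ g : G, orderOf g = 2 ^ (m + 1) := by
  classical
  set A := Subgroup.zpowers a with hA
  haveI hHn : H.Normal := Subgroup.normal_of_index_eq_two hH
  have h2m : 2 ^ m = 2 * 2 ^ (m - 1) := by rw [← pow_succ', show m - 1 + 1 = m from by omega]
  have h8 : 8 ≤ 2 ^ m := by
    calc (8 : ℕ) = 2 ^ 3 := by norm_num
      _ ≤ 2 ^ m := Nat.pow_le_pow_right (by norm_num) hm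
  have hAH : A ≤ H := by
    rw [hA, Subgroup.zpowers_le]
    exact haH
  have hAcard : Nat.card A = 2 ^ m := by rw [hA, Nat.card_zpowers, ha]
  -- basic facts on `a`, `z`
  have hz2 : a ^ (2 ^ (m - 1)) * a ^ (2 ^ (m - 1)) = 1 := by
    rw [← pow_add, ← two_mul, ← h2m, ← ha, pow_orderOf_eq_one]
  have hz1 : a ^ (2 ^ (m - 1)) ≠ 1 := by
    intro h
    have hd : orderOf a ∣ 2 ^ (m - 1) := orderOf_dvd_of_pow_eq_one h
    rw [ha] at hd
    have := Nat.le_of_dvd (by positivity) hd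
    omega
  have hainv : a⁻¹ ≠ a := by
    intro h
    rw [inv_eq_iff_mul_eq_one] at h
    have hd : orderOf a ∣ 2 := by
      apply orderOf_dvd_of_pow_eq_one
      rw [pow_two, h]
    rw [ha] at hd
    have := Nat.le_of_dvd (by norm_num) hd
    omega
  -- (1) `A` is normal in `G`: every conjugate of `a` lies in `A`
  have hconjA : ∀ g : G, g * a * g⁻¹ ∈ A := by
    intro g
    by_cases hg : g ∈ H
    · by_cases hgA : g ∈ A
      · rw [hA, Subgroup.mem_zpowers_iff] at hgA
        obtain ⟨i, rfl⟩ := hgA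
        rw [show a ^ i * a * (a ^ i)⁻¹ = a by group]
        exact Subgroup.mem_zpowers a
      · rw [(hrel g hg hgA).1]
        exact A.inv_mem (Subgroup.mem_zpowers a)
    · by_contra hc
      have hcH : g * a * g⁻¹ ∈ H := hHn.conj_mem a haH g
      have hsq := (hrel _ hcH hc).2
      -- `(g a g⁻¹)² = z` gives `a² = g⁻¹ z g`, an involution, hence `a² = z`, impossible for `m ≥ 3`
      have hsq' : a * a = g⁻¹ * a ^ (2 ^ (m - 1)) * g := by
        rw [show a * a = g⁻¹ * ((g * a * g⁻¹) * (g * a * g⁻¹)) * g by group, hsq]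
      have hinv2 : (g⁻¹ * a ^ (2 ^ (m - 1)) * g) * (g⁻¹ * a ^ (2 ^ (m - 1)) * g) = 1 := by
        rw [show (g⁻¹ * a ^ (2 ^ (m - 1)) * g) * (g⁻¹ * a ^ (2 ^ (m - 1)) * g) =
          g⁻¹ * (a ^ (2 ^ (m - 1)) * a ^ (2 ^ (m - 1))) * g by group, hz2]
        group
      have hinv1 : g⁻¹ * a ^ (2 ^ (m - 1)) * g ≠ 1 := by
        intro h
        apply hz1
        have := congrArg (fun t => g * t * g⁻¹) h
        simpa [mul_assoc] using this
      have haa : a * a = a ^ (2 ^ (m - 1)) := by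
        rw [hsq']
        refine huniq _ _ hinv2 hinv1 hz2 hz1
      rw [← pow_two, pow_eq_pow_iff_modEq, ha] at haa
      have h2lt : 2 < 2 ^ m := by omega
      have hlt : 2 ^ (m - 1) < 2 ^ m := by omega
      have := Nat.ModEq.eq_of_lt_of_lt haa h2lt hlt
      -- `2 = 2^(m-1)` contradicts `m ≥ 3`
      have h4 : 4 ≤ 2 ^ (m - 1) := by
        calc (4 : ℕ) = 2 ^ 2 := by norm_num
          _ ≤ 2 ^ (m - 1) := Nat.pow_le_pow_right (by norm_num) (by omega)
      omega
  haveI hAn : A.Normal := by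
    refine ⟨fun n hn g => ?_⟩
    rw [hA, Subgroup.mem_zpowers_iff] at hn
    obtain ⟨i, rfl⟩ := hn
    have : g * a ^ i * g⁻¹ = (g * a * g⁻¹) ^ i := by
      rw [← MulAut.conj_apply, map_zpow, MulAut.conj_apply]
    rw [this]
    exact A.zpow_mem (hconjA g) i
  obtain hconjr : ∀ g : G, ∃ r : ℕ, g * a * g⁻¹ = a ^ r := by
    intro g
    have hmem := hconjA g
    rw [hA, ← mem_powers_iff_mem_zpowers, Submonoid.mem_powers_iff] at hmem
    obtain ⟨r, hr⟩ := hmem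
    exact ⟨r, hr.symm⟩
  -- (2) the quotient `G/A` has order `4`; subgroups `A ∪ uA` for `u² ∈ A`
  set π := QuotientGroup.mk' A with hπ
  have hAidx : A.index = 4 := by
    have h1 := A.index_mul_card
    rw [hAcard, hcard, pow_add] at h1
    have : A.index * 2 ^ m = 4 * 2 ^ m := by rw [h1]; ring
    exact Nat.eq_of_mul_eq_mul_right (by positivity) this
  -- the index-two subgroup `K_u = π⁻¹ ⟨π u⟩` for `u ∉ A` with `u² ∈ A`
  have hK : ∀ u : G, u ∉ A → u * u ∈ A →
      Nat.card ((Subgroup.zpowers (π u)).comap π) = 2 ^ (m + 1) ∧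
      (∀ k : G, k ∈ (Subgroup.zpowers (π u)).comap π → k ∉ A → ∃ a' ∈ A, u * a' = k) := by
    intro u huA huu
    have hπu1 : π u ≠ 1 := fun h => huA ((QuotientGroup.eq_one_iff u).1 h)
    have hπu2 : π u * π u = 1 := by rw [← map_mul]; exact (QuotientGroup.eq_one_iff _).2 huu
    have hord : orderOf (π u) = 2 := orderOf_eq_prime (by rw [pow_two, hπu2]) hπu1
    refine ⟨?_, ?_⟩
    · have hidx : ((Subgroup.zpowers (π u)).comap π).index = 2 := by
        rw [(Subgroup.zpowers (π u)).index_comap_of_surjective (QuotientGroup.mk'_surjective A)]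
        have h1 := (Subgroup.zpowers (π u)).index_mul_card
        rw [Nat.card_zpowers, hord, ← Subgroup.index_eq_card, hAidx] at h1
        omega
      have h1 := ((Subgroup.zpowers (π u)).comap π).index_mul_card
      rw [hidx, hcard, pow_succ, mul_comm _ 2] at h1
      exact Nat.eq_of_mul_eq_mul_left (by norm_num) h1
    · intro k hk hkA
      rw [Subgroup.mem_comap, ← mem_powers_iff_mem_zpowers, Submonoid.mem_powers_iff] at hk
      obtain ⟨n, hn⟩ := hk
      obtain ⟨t, ht | ht⟩ := Nat.even_or_odd' n
      · exfalso
        apply hkA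
        rw [ht, pow_mul, pow_two, hπu2, one_pow] at hn
        exact (QuotientGroup.eq_one_iff k).1 hn.symm
      · rw [ht, pow_succ, pow_mul, pow_two, hπu2, one_pow, one_mul] at hn
        obtain ⟨a', ha', h⟩ := (QuotientGroup.mk'_eq_mk' A).1 hn
        exact ⟨a', ha', h⟩
  -- (3) applying the cyclic-index-two theorem to such a `K_u`
  have hLemmaC : ∀ u : G, u ∉ A → u * u ∈ A →
      (∃ g : G, orderOf g = 2 ^ (m + 1)) ∨
      (∃ x : G, (∃ a' ∈ A, u * a' = x) ∧ x * a * x⁻¹ = a⁻¹) := by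
    intro u huA huu
    obtain ⟨hKcard, hKmem⟩ := hK u huA huu
    set K := (Subgroup.zpowers (π u)).comap π with hKdef
    have hπa : π a = 1 := (QuotientGroup.eq_one_iff a).2 (Subgroup.mem_zpowers a)
    have haK : a ∈ K := by
      rw [hKdef, Subgroup.mem_comap, hπa]
      exact one_mem _
    have haK' : orderOf (⟨a, haK⟩ : K) = 2 ^ m := by rw [Subgroup.orderOf_mk, ha]
    rcases isCyclic_or_exists_relations_of_orderOf_eq_two_pow (G := K) (by omega) hKcard haK'
        (subsingleton_involution_subgroup huniq K) with hcyc | ⟨-, x, hx, hxa, -⟩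
    · left
      obtain ⟨g, hg⟩ := hcyc.exists_ofOrder_eq_natCard
      exact ⟨g, by rw [Subgroup.orderOf_coe, hg, hKcard]⟩
    · right
      have hxA : (x : G) ∉ A := fun h => hx ((mem_zpowers_mk_iff haK x).2 h)
      refine ⟨x, hKmem x x.2 hxA, ?_⟩
      have := congrArg Subtype.val hxa
      simpa using this
  -- (4) an element `y ∉ H` and an element `x₀ ∈ H ∖ A`
  obtain ⟨y, hyH⟩ : ∃ y : G, y ∉ H := by
    by_contra h
    push Not at h
    have htop : H = ⊤ := (Subgroup.eq_top_iff' H).2 h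
    rw [htop, Subgroup.index_top] at hH
    norm_num at hH
  have hyA : y ∉ A := fun h => hyH (hAH h)
  obtain ⟨x₀, hx₀H, hx₀A⟩ : ∃ x₀ : G, x₀ ∈ H ∧ x₀ ∉ A := by
    by_contra h
    push Not at h
    have hHA : H ≤ A := fun g hg => h g hg
    have hle := Subgroup.card_le_of_le hHA
    have hHcard : Nat.card H = 2 ^ (m + 1) := by
      have h1 := H.index_mul_card
      rw [hH, hcard, pow_succ, mul_comm _ 2] at h1
      exact Nat.eq_of_mul_eq_mul_left (by norm_num) h1
    rw [hAcard, hHcard, pow_succ] at hle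
    omega
  have hx₀a := (hrel x₀ hx₀H hx₀A).1
  -- membership tools for the index-two subgroup `H`
  have hmulH : ∀ g h : G, g ∈ H → h ∉ H → g * h ∉ H := fun g h hg hh hgh =>
    hh (((Subgroup.mul_mem_iff_of_index_two hH).1 hgh).1 hg)
  -- (5) `y² ∈ A`: otherwise `y²` inverts `a` and `a^(r²) = a⁻¹`
  obtain ⟨r, hr⟩ := hconjr y
  have hyy : y * y ∈ A := by
    by_contra hyyA
    have hyyH : y * y ∈ H := Subgroup.mul_self_mem_of_index_two hH y
    have hinv := (hrel _ hyyH hyyA).1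
    have hrr : y * y * a * (y * y)⁻¹ = a ^ (r * r) := by
      rw [show y * y * a * (y * y)⁻¹ = y * (y * a * y⁻¹) * y⁻¹ by group, hr, ← MulAut.conj_apply, map_pow,
        MulAut.conj_apply, hr, ← pow_mul]
    rw [hinv, inv_eq_iff_mul_eq_one, ← pow_succ'] at hrr
    have hd : orderOf a ∣ r * r + 1 := orderOf_dvd_of_pow_eq_one hrr
    rw [ha] at hd
    have h4 : 4 ∣ r * r + 1 := (show (4 : ℕ) ∣ 2 ^ m from ⟨2 ^ (m - 2), by
      rw [show (4 : ℕ) = 2 ^ 2 by norm_num, ← pow_add, show 2 + (m - 2) = m from by omega]⟩).trans hd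
    have hmod : r * r % 4 = 0 ∨ r * r % 4 = 1 := by
      have h := Nat.mod_lt r (show 0 < 4 by norm_num)
      rw [Nat.mul_mod]
      interval_cases (r % 4) <;> simp
    omega
  -- (6) the subgroup `A ∪ yA`
  rcases hLemmaC y hyA hyy with hg | ⟨y', ⟨a', ha'A, hya'⟩, hy'a⟩
  · exact Or.inr hg
  · -- `y' = y a'` inverts `a`; `u = x₀ y'` centralises `a`
    have hy'H : y' ∉ H := by
      rw [← hya']
      intro h
      exact hyH (((Subgroup.mul_mem_iff_of_index_two hH).1 h).2 (hAH ha'A))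
    set u := x₀ * y' with hu
    have huH : u ∉ H := hmulH x₀ y' hx₀H hy'H
    have huA : u ∉ A := fun h => huH (hAH h)
    have hua : u * a * u⁻¹ = a := by
      rw [hu, show x₀ * y' * a * (x₀ * y')⁻¹ = x₀ * (y' * a * y'⁻¹) * x₀⁻¹ by group, hy'a,
        show x₀ * a⁻¹ * x₀⁻¹ = (x₀ * a * x₀⁻¹)⁻¹ by group, hx₀a, inv_inv]
    have huu : u * u ∈ A := by
      by_contra huuA
      have huuH : u * u ∈ H := Subgroup.mul_self_mem_of_index_two hH u
      have hinv := (hrel _ huuH huuA).1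
      have : u * u * a * (u * u)⁻¹ = a := by
        rw [show u * u * a * (u * u)⁻¹ = u * (u * a * u⁻¹) * u⁻¹ by group, hua, hua]
      rw [this] at hinv
      exact hainv hinv.symm
    rcases hLemmaC u huA huu with hg | ⟨x₂, ⟨a₂, ha₂A, hxa₂⟩, hx₂a⟩
    · exact Or.inr hg
    · -- `x₂ = u a₂` centralises `a`, yet inverts it
      exfalso
      rw [hA, Subgroup.mem_zpowers_iff] at ha₂A
      obtain ⟨i, rfl⟩ := ha₂A
      have : x₂ * a * x₂⁻¹ = a := by
        rw [← hxa₂, show u * a ^ i * a * (u * a ^ i)⁻¹ = u * a * u⁻¹ by group, hua]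
      rw [this] at hx₂a
      exact hainv hx₂a.symm

/-! ## §3 A quaternion subgroup `Q₈` of index two (`|G| = 16`) -/

/-- **The case `m = 2`**: `|G| = 16` with at most one involution, `H ≤ G` of index `2`, `a ∈ H` of order `4`, every
`h ∈ H ∖ ⟨a⟩` inverting `a` and squaring to `a²` (so `H ≅ Q₈`) ⟹ `G` is cyclic or has an element of order `8`.  (If not, every
element outside `{1, a²}` squares to `a²`; then `y ∉ H` inverts `a`, `x₀` and `a x₀` by conjugation, forcing `a x₀ = x₀ a`.)
[cite: Rotman1995, Thm. 5.46] -/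
theorem exists_orderOf_eq_of_quaternion_subgroup_two [Finite G] {H : Subgroup G} {a : G}
    (hcard : Nat.card G = 16) (hH : H.index = 2) (haH : a ∈ H) (ha : orderOf a = 4)
    (hrel : ∀ h ∈ H, h ∉ Subgroup.zpowers a → h * a * h⁻¹ = a⁻¹ ∧ h * h = a ^ 2)
    (huniq : ∀ s t : G, s * s = 1 → s ≠ 1 → t * t = 1 → t ≠ 1 → s = t) :
    IsCyclic G ∨ ∃ g : G, orderOf g = 8 := by
  classical
  set A := Subgroup.zpowers a with hA
  have hAH : A ≤ H := by
    rw [hA, Subgroup.zpowers_le]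
    exact haH
  have hAcard : Nat.card A = 4 := by rw [hA, Nat.card_zpowers, ha]
  have ha4 : a ^ 4 = 1 := by rw [← ha, pow_orderOf_eq_one]
  have hz2 : a ^ 2 * a ^ 2 = 1 := by rw [← pow_add, ha4]
  have hz1 : a ^ 2 ≠ 1 := by
    intro h
    have hd : orderOf a ∣ 2 := orderOf_dvd_of_pow_eq_one h
    rw [ha] at hd
    omega
  have hzH : a ^ 2 ∈ H := H.pow_mem haH 2
  have hainv : a⁻¹ ≠ a := by
    intro h
    rw [inv_eq_iff_mul_eq_one, ← pow_two] at h
    exact hz1 h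
  by_contra hcon
  push Not at hcon
  obtain ⟨hncyc, hn8⟩ := hcon
  -- every element outside `{1, a²}` squares to `a²`
  have hsq : ∀ g : G, g ≠ 1 → g ≠ a ^ 2 → g * g = a ^ 2 := by
    intro g hg1 hgz
    have hdvd : orderOf g ∣ 2 ^ 4 := by rw [show (2:ℕ) ^ 4 = 16 by norm_num, ← hcard]; exact orderOf_dvd_natCard g
    obtain ⟨j, hj, hjg⟩ := (Nat.dvd_prime_pow Nat.prime_two).1 hdvd
    interval_cases j
    · exact absurd (orderOf_eq_one_iff.1 (by simpa using hjg)) hg1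
    · have hgg : g * g = 1 := by rw [← pow_two, ← show orderOf g = 2 by simpa using hjg, pow_orderOf_eq_one]
      exact absurd (huniq g (a ^ 2) hgg hg1 hz2 hz1) hgz
    · have hg4 : (g * g) * (g * g) = 1 := by
        rw [← pow_two, ← pow_two, ← pow_mul, show 2 * 2 = orderOf g by rw [hjg]; norm_num, pow_orderOf_eq_one]
      have hgg : g * g ≠ 1 := by
        intro h
        have hd : orderOf g ∣ 2 := orderOf_dvd_of_pow_eq_one (by rw [pow_two, h])
        rw [show orderOf g = 4 by simpa using hjg] at hd
        omega
      exact huniq _ _ hg4 hgg hz2 hz1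
    · exact absurd (by simpa using hjg) (hn8 g)
    · exact absurd (isCyclic_of_orderOf_eq_card g (by rw [hjg, hcard]; norm_num)) hncyc
  -- `y ∉ H`, `x₀ ∈ H ∖ A`
  obtain ⟨y, hyH⟩ : ∃ y : G, y ∉ H := by
    by_contra h
    push Not at h
    have htop : H = ⊤ := (Subgroup.eq_top_iff' H).2 h
    rw [htop, Subgroup.index_top] at hH
    norm_num at hH
  obtain ⟨x₀, hx₀H, hx₀A⟩ : ∃ x₀ : G, x₀ ∈ H ∧ x₀ ∉ A := by
    by_contra h
    push Not at h
    have hHA : H ≤ A := fun g hg => h g hg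
    have hle := Subgroup.card_le_of_le hHA
    have hHcard : Nat.card H = 8 := by
      have h1 := H.index_mul_card
      rw [hH, hcard] at h1
      omega
    rw [hAcard, hHcard] at hle
    omega
  have hx₀a := (hrel x₀ hx₀H hx₀A).1
  have hx₀x₀ := (hrel x₀ hx₀H hx₀A).2
  have hax₀H : a * x₀ ∈ H := H.mul_mem haH hx₀H
  have hax₀A : a * x₀ ∉ A := fun h => hx₀A (by simpa using A.mul_mem (A.inv_mem (Subgroup.mem_zpowers a)) h)
  have hax₀sq := (hrel _ hax₀H hax₀A).2
  -- squares outside `H`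
  have houtH : ∀ g : G, g ∉ H → g * g = a ^ 2 := fun g hg =>
    hsq g (fun h => hg (h ▸ H.one_mem)) (fun h => hg (h ▸ hzH))
  have hmulH : ∀ h : G, h ∈ H → y * h ∉ H := fun h hh hyh =>
    hyH (((Subgroup.mul_mem_iff_of_index_two hH).1 hyh).2 hh)
  -- `y` inverts every `g` with `g² = a² = (yg)²`
  have hflip : ∀ g : G, g * g = a ^ 2 → y * g * (y * g) = a ^ 2 → y⁻¹ * g * y = g⁻¹ := by
    intro g hgg hyg
    have hyy := houtH y hyH
    have h3 : g * y * g = y := by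
      apply mul_left_cancel (a := y)
      rw [show y * (g * y * g) = y * g * (y * g) by group, hyg, hyy]
    calc y⁻¹ * g * y = y⁻¹ * (g * y * g) * g⁻¹ := by group
      _ = g⁻¹ := by rw [h3]; group
  have h1 := hflip a (pow_two a).symm (houtH _ (hmulH a haH))
  have h2 := hflip x₀ hx₀x₀ (houtH _ (hmulH x₀ hx₀H))
  have h3 := hflip (a * x₀) hax₀sq (houtH _ (hmulH _ hax₀H))
  have h4 : y⁻¹ * (a * x₀) * y = a⁻¹ * x₀⁻¹ := by
    rw [show y⁻¹ * (a * x₀) * y = (y⁻¹ * a * y) * (y⁻¹ * x₀ * y) by group, h1, h2]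
  rw [h4, mul_inv_rev] at h3
  -- `a` and `x₀` commute, so `x₀ a x₀⁻¹ = a`, contradicting `x₀ a x₀⁻¹ = a⁻¹ ≠ a`
  apply hainv
  rw [← hx₀a]
  have h5 : a * x₀ = x₀ * a := by
    have := congrArg (fun t => t⁻¹) h3
    simp only [mul_inv_rev, inv_inv] at this
    exact this.symm
  rw [← h5, mul_inv_cancel_right]

end Literature.GroupTheory.UniqueInvolution
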